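import Literature.NumberTheory.Rogawski1990.ArchStableSumG                     -- ★ (2) (LH10-p02 (g9)) p851904: `stableSumG`, `stableTwistG`, `StInRegG`; brings ★ `partnerPerms ∕ slotPerm ∕ RegG ∕ archRG`
import HarnessLib

/-!
# The stable sum, the unit twist, the normaliser and the partner labels are PRODUCTS OVER PLACES: the `D ⊔ I` factorisation of `stableSumG` for tensor families (N8-INNER ROAD B, brick (12′)
# «EP ASSEMBLY», FILE P; Shelstad 1979 §4 Lemma 4.2; Rogawski 1990 §4.1 (4.1.1), §8.2)

Topic `NumberTheory/Rogawski1990`; namespace `Literature.NumberTheory.Rogawski1990`.  THEOREMS ONLY (no `def`, no instance, no notation, no axiom, no named fact, no `sorry`).  GENERIC in the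
index type `W` of places and a decidable predicate `p : W → Prop` («`w ∈ D`», the `α`-definite places); the two blocks are the sub-index types `{w // p w}` and `{w // ¬ p w}`, on which ★
`partnerPerms`, ★ `slotPerm`, ★ `stableTwistG`, ★ `stableSumG`, ★ `archRG`, ★ `RegG` are the SAME generic definitions (no new definition).  Cell `pub/hodgecm-mathlib`, crux H413
(`stmt-HodgeConjecture-24833`), F0∕P3c road «N8-INNER» ROAD B (LH2-plan (g1) 16:08:52Z), brick (12′) «EP ASSEMBLY» (deal 16:12:42Z → LH7-p01 (g7); CENSUS `F0/P3c/LH7/LH7-p01/g7/ep/CENSUS-N8-brick12EP.v1.LH7p01g7.md`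
4b6e6521d5d67659 §1).  Count-neutral bookkeeping.

THE POINT.  ★ `partnerPerms S′ = piFinset (w ↦ {1} | univ)`, ★ `stableTwistG S′ ρ c = (∏_w sign ρ_w) · ∏_w (1 | phase_w)`, ★ `archRG S′ c = ∏_w (split | compact factor)` and ★ `slotPerm` acts place by
place — so along a decomposition of the places `W = {p} ⊔ {¬p}` (Mathlib `Fintype.prod_subtype_mul_prod_subtype`, `Equiv.piEquivPiSubtypeProd`):
* §1 RESTRICTION: `slotPerm_restrict` (`(slotPerm ρ c)|_p = slotPerm ρ|_p c|_p`, `rfl`), `mem_partnerPerms_restrict`, `mem_partnerPerms_iff_restrict`, `mem_regG_iff_restrict` ((P6)), `mem_stInRegG_iff_restrict`;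
* §2 TWIST AND NORMALISER: **`stableTwistG_eq_restrict_mul_restrict`** ((P2)), **`archRG_eq_restrict_mul_restrict`** ((P3));
* §3 PARTNER SUMS: **`sum_partnerPerms_eq_sum_sum_restrict`** ((P1): `Σ_{ρ ∈ partnerPerms S′} G ρ = Σ_{ρ₁ ∈ partnerPerms S′|_p} Σ_{ρ₂ ∈ partnerPerms S′|_{¬p}} G (ρ₁ ⊔ ρ₂)`), **`sum_partnerPerms_mul_eq_sum_mul_sum`**
  ((P5): the PLAIN partner sum of a tensor `Φ₁ (ρ|_p · c|_p) · Φ₂ (ρ|_{¬p} · c|_{¬p})` is the product of the two plain partner sums — what ★ READ-G `stableOrbitalIntegralRel_gprimeTorus_mul_boxMass_eq_sum` and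
  the one-place EP generators read);
* §4 **`stableSumG_eq_mul_of_tensor_at`** ((P4), the dealer's «first lemma», POINTWISE: the tensor hypothesis only at the partner points of `(S′, c)` — LHref-N BOX #23) and the global
  `stableSumG_eq_mul_of_tensor`: `stableSumG F S′ c = stableSumG F₁ (S′|_p) (c|_p) · stableSumG F₂ (S′|_{¬p}) (c|_{¬p})` — NO cross-place term: ROAD B's premise, (12b) unnecessary.
HONEST LABEL: HC_CM is proved only modulo the 7 printed citations (2 remaining: hLiu418 = `stmt-HodgeConjecture-24832`, h413 = `stmt-HodgeConjecture-24833`) until rung 0 closes; count-neutral until the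
junction payer is ★ and ED. 43 re-keys 27456 6 → 5.

## References
* [Shelstad1979] D. Shelstad, *Characters and inner forms of a quasi-split group over ℝ*, Compositio Math. 39 (1979), §4 pp. 22–24, Lemma 4.2 p. 23 (the relabellings place by place).
* [Rogawski1990] J. D. Rogawski, *Automorphic Representations of Unitary Groups in Three Variables*, Ann. of Math. Stud. 123 (1990), §4.1 (4.1.1) p. 39, §8.2 pp. 118–122 (`G_∞ = Π_v G_v`,
  orbital integrals place by place).
* [BorelJacquet1979] A. Borel, H. Jacquet, *Automorphic forms and automorphic representations*, PSPM 33.1 (1979), §4.1 (product structure at the infinite places).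
-/

set_option autoImplicit false

noncomputable section

open Complex Finset Equiv
open scoped Classical
open Literature.NumberTheory.Automorphic.ArchCartan

namespace Literature.NumberTheory.Rogawski1990

variable {W : Type*} [Fintype W] [DecidableEq W] (p : W → Prop) [DecidablePred p]

/-! ## §1 Restriction of labels, coordinates and relabellings to a block of places -/

section Restrict

omit [Fintype W] [DecidableEq W] [DecidablePred p] in
/-- `(slotPerm ρ c)|_p = slotPerm ρ|_p c|_p` (definitional). [cite: Shelstad1979, Lemma 4.2 p. 23] -/
theorem slotPerm_restrict (ρ : W → Equiv.Perm (Fin 3)) (c : W → Fin 3 → ℝ) :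
    (fun w : {w // p w} => slotPerm ρ c w.1) = slotPerm (fun w : {w // p w} => ρ w.1) (fun w : {w // p w} => c w.1) := rfl

/-- A partner relabelling of `S′` restricts to a partner relabelling of `S′|_p`. [cite: Shelstad1979, Lemma 4.2 p. 23] -/
theorem mem_partnerPerms_restrict {S' : Finset W} {ρ : W → Equiv.Perm (Fin 3)} (h : ρ ∈ partnerPerms S') :
    (fun w : {w // p w} => ρ w.1) ∈ partnerPerms (S'.subtype p) :=
  (mem_partnerPerms_iff _ _).2 fun _ hw => eq_one_of_mem_partnerPerms h (Finset.mem_subtype.1 hw)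

/-- **`partnerPerms` is a product over the two blocks**: `ρ ∈ partnerPerms S′` iff both restrictions are partner relabellings. [cite: Shelstad1979, Lemma 4.2 p. 23] -/
theorem mem_partnerPerms_iff_restrict (S' : Finset W) (ρ : W → Equiv.Perm (Fin 3)) :
    ρ ∈ partnerPerms S' ↔ (fun w : {w // p w} => ρ w.1) ∈ partnerPerms (S'.subtype p) ∧ (fun w : {w // ¬ p w} => ρ w.1) ∈ partnerPerms (S'.subtype fun w => ¬ p w) := by
  refine ⟨fun h => ⟨mem_partnerPerms_restrict p h, mem_partnerPerms_restrict (fun w => ¬ p w) h⟩, fun h => (mem_partnerPerms_iff _ _).2 fun w hw => ?_⟩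
  by_cases hp : p w
  · exact (mem_partnerPerms_iff _ _).1 h.1 ⟨w, hp⟩ (Finset.mem_subtype.2 hw)
  · exact (mem_partnerPerms_iff _ _).1 h.2 ⟨w, hp⟩ (Finset.mem_subtype.2 hw)

omit [Fintype W] [DecidableEq W] in
/-- **`RegG` is a product over the two blocks** ((P6)). [cite: Rogawski1990, §8.2 p. 118] -/
theorem mem_regG_iff_restrict (S' : Finset W) (c : W → Fin 3 → ℝ) :
    c ∈ RegG S' ↔ (fun w : {w // p w} => c w.1) ∈ RegG (S'.subtype p) ∧ (fun w : {w // ¬ p w} => c w.1) ∈ RegG (S'.subtype fun w => ¬ p w) := by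
  simp only [mem_regG_iff, Finset.mem_subtype]
  constructor
  · rintro ⟨h1, h2⟩
    exact ⟨⟨fun w hw => h1 w.1 hw, fun w hw => h2 w.1 hw⟩, ⟨fun w hw => h1 w.1 hw, fun w hw => h2 w.1 hw⟩⟩
  · rintro ⟨⟨h1, h2⟩, ⟨h3, h4⟩⟩
    refine ⟨fun w hw => ?_, fun w hw => ?_⟩
    · by_cases hp : p w
      · exact h1 ⟨w, hp⟩ hw
      · exact h3 ⟨w, hp⟩ hw
    · by_cases hp : p w
      · exact h2 ⟨w, hp⟩ hw
      · exact h4 ⟨w, hp⟩ hw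

omit [Fintype W] [DecidableEq W] in
/-- **`StInRegG` is a product over the two blocks.** [cite: Rogawski1990, §8.2 p. 118] -/
theorem mem_stInRegG_iff_restrict (S' : Finset W) (c : W → Fin 3 → ℝ) :
    c ∈ StInRegG S' ↔ (fun w : {w // p w} => c w.1) ∈ StInRegG (S'.subtype p) ∧ (fun w : {w // ¬ p w} => c w.1) ∈ StInRegG (S'.subtype fun w => ¬ p w) := by
  simp only [mem_stInRegG_iff, Finset.mem_subtype]
  constructor
  · intro h
    exact ⟨fun w hw => h w.1 hw, fun w hw => h w.1 hw⟩
  · rintro ⟨h1, h2⟩ w hw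
    by_cases hp : p w
    · exact h1 ⟨w, hp⟩ hw
    · exact h2 ⟨w, hp⟩ hw

end Restrict

/-! ## §2 The unit twist and the normaliser factor over the blocks -/

section Twist

/-- **`u_ρ(c) = u_{ρ|_p}(c|_p) · u_{ρ|_{¬p}}(c|_{¬p})`** ((P2): both factors of ★ `stableTwistG` are products over places). [cite: Shelstad1979, §4 p. 24; Lemma 4.2 p. 23] -/
theorem stableTwistG_eq_restrict_mul_restrict (S' : Finset W) (ρ : W → Equiv.Perm (Fin 3)) (c : W → Fin 3 → ℝ) :
    stableTwistG S' ρ c =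
      stableTwistG (S'.subtype p) (fun w : {w // p w} => ρ w.1) (fun w : {w // p w} => c w.1) *
        stableTwistG (S'.subtype fun w => ¬ p w) (fun w : {w // ¬ p w} => ρ w.1) (fun w : {w // ¬ p w} => c w.1) := by
  unfold stableTwistG
  simp only [Finset.mem_subtype]
  rw [← Fintype.prod_subtype_mul_prod_subtype p (fun w => (Equiv.Perm.sign (ρ w) : ℂ)),
    ← Fintype.prod_subtype_mul_prod_subtype p (fun w => if w ∈ S' then (1 : ℂ) else ((Circle.exp (c w (ρ w 0) - c w (ρ w 2)) * (Circle.exp (c w 0 - c w 2))⁻¹ : Circle) : ℂ))]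
  ring

/-- **`R′_{S′}(c) = R′_{S′|_p}(c|_p) · R′_{S′|_{¬p}}(c|_{¬p})`** ((P3): ★ `archRG` is a product over places). [cite: Shelstad1979, §4 p. 22] [cite: Rogawski1990, §8.2 p. 118] -/
theorem archRG_eq_restrict_mul_restrict (S' : Finset W) (c : W → Fin 3 → ℝ) :
    archRG S' c = archRG (S'.subtype p) (fun w : {w // p w} => c w.1) * archRG (S'.subtype fun w => ¬ p w) (fun w : {w // ¬ p w} => c w.1) := by
  unfold archRG
  simp only [Finset.mem_subtype]
  rw [← Fintype.prod_subtype_mul_prod_subtype p (fun w => if w ∈ S' then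
      ((|Real.exp (c w 0) - Real.exp (-c w 0)| *
          ‖Complex.exp (c w 0 + c w 2 * I) - Complex.exp (c w 1 * I)‖ * ‖Complex.exp (-c w 0 + c w 2 * I) - Complex.exp (c w 1 * I)‖ : ℝ) : ℂ)
    else (1 - (Circle.exp (c w 1 - c w 0) : ℂ)) * (1 - (Circle.exp (c w 2 - c w 0) : ℂ)) * (1 - (Circle.exp (c w 2 - c w 1) : ℂ)))]

end Twist

/-! ## §3 Partner sums over the blocks -/

section Sums

variable {M : Type*} [AddCommMonoid M]

omit [Fintype W] [DecidableEq W] in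
/-- Gluing the two restrictions back (`Equiv.piEquivPiSubtypeProd`): the `p`-restriction of `ρ₁ ⊔ ρ₂` is `ρ₁`. [folklore] [cite: Shelstad1979, Lemma 4.2 p. 23] -/
theorem restrict_piEquivPiSubtypeProd_symm_fst (ρ₁ : {w // p w} → Equiv.Perm (Fin 3)) (ρ₂ : {w // ¬ p w} → Equiv.Perm (Fin 3)) :
    (fun w : {w // p w} => (Equiv.piEquivPiSubtypeProd p (fun _ : W => Equiv.Perm (Fin 3))).symm (ρ₁, ρ₂) w.1) = ρ₁ := by
  funext w
  rw [Equiv.piEquivPiSubtypeProd_symm_apply, dif_pos w.2]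

omit [Fintype W] [DecidableEq W] in
/-- The `¬p`-restriction of `ρ₁ ⊔ ρ₂` is `ρ₂`. [folklore] [cite: Shelstad1979, Lemma 4.2 p. 23] -/
theorem restrict_piEquivPiSubtypeProd_symm_snd (ρ₁ : {w // p w} → Equiv.Perm (Fin 3)) (ρ₂ : {w // ¬ p w} → Equiv.Perm (Fin 3)) :
    (fun w : {w // ¬ p w} => (Equiv.piEquivPiSubtypeProd p (fun _ : W => Equiv.Perm (Fin 3))).symm (ρ₁, ρ₂) w.1) = ρ₂ := by
  funext w
  rw [Equiv.piEquivPiSubtypeProd_symm_apply, dif_neg w.2]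

/-- **THE PARTNER LABELS ARE A PRODUCT OVER THE BLOCKS** ((P1)): `Σ_{ρ ∈ partnerPerms S′} G ρ = Σ_{ρ₁ ∈ partnerPerms S′|_p} Σ_{ρ₂ ∈ partnerPerms S′|_{¬p}} G (ρ₁ ⊔ ρ₂)`
(★ `partnerPerms = piFinset`, split along `Equiv.piEquivPiSubtypeProd p`). [cite: Shelstad1979, Lemma 4.2 p. 23] [cite: Rogawski1990, §4.1 (4.1.1) p. 39] -/
theorem sum_partnerPerms_eq_sum_sum_restrict (S' : Finset W) (G : (W → Equiv.Perm (Fin 3)) → M) :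
    ∑ ρ ∈ partnerPerms S', G ρ =
      ∑ ρ₁ ∈ partnerPerms (S'.subtype p), ∑ ρ₂ ∈ partnerPerms (S'.subtype fun w => ¬ p w),
        G ((Equiv.piEquivPiSubtypeProd p (fun _ : W => Equiv.Perm (Fin 3))).symm (ρ₁, ρ₂)) := by
  rw [← Finset.sum_product (s := partnerPerms (S'.subtype p)) (t := partnerPerms (S'.subtype fun w => ¬ p w))
    (f := fun x => G ((Equiv.piEquivPiSubtypeProd p (fun _ : W => Equiv.Perm (Fin 3))).symm (x.1, x.2)))]
  refine Finset.sum_equiv (Equiv.piEquivPiSubtypeProd p (fun _ : W => Equiv.Perm (Fin 3))) (fun ρ => ?_) (fun ρ _ => ?_)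
  · rw [Finset.mem_product, mem_partnerPerms_iff_restrict p S' ρ]
    rfl
  · rw [Equiv.symm_apply_apply]

/-- **THE PLAIN PARTNER SUM OF A TENSOR FACTORISES** ((P5)): `Σ_{ρ ∈ partnerPerms S′} Φ₁ (ρ|_p · c|_p) · Φ₂ (ρ|_{¬p} · c|_{¬p}) = (Σ_{ρ₁} Φ₁ (ρ₁ · c|_p)) · (Σ_{ρ₂} Φ₂ (ρ₂ · c|_{¬p}))`
— the reading of ★ READ-G (`partnerWeight · Σ_ρ chartOrbG … (slotPerm ρ c)`) and of the one-place EP generators over a block decomposition. [cite: Shelstad1979, Lemma 4.2 p. 23]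
[cite: Rogawski1990, §4.1 (4.1.1) p. 39; §8.2 p. 122] -/
theorem sum_partnerPerms_mul_eq_sum_mul_sum {R : Type*} [CommSemiring R] (S' : Finset W) (c : W → Fin 3 → ℝ)
    (Φ₁ : ({w // p w} → Fin 3 → ℝ) → R) (Φ₂ : ({w // ¬ p w} → Fin 3 → ℝ) → R) :
    ∑ ρ ∈ partnerPerms S', Φ₁ (slotPerm (fun w : {w // p w} => ρ w.1) (fun w : {w // p w} => c w.1)) *
        Φ₂ (slotPerm (fun w : {w // ¬ p w} => ρ w.1) (fun w : {w // ¬ p w} => c w.1)) =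
      (∑ ρ₁ ∈ partnerPerms (S'.subtype p), Φ₁ (slotPerm ρ₁ (fun w : {w // p w} => c w.1))) *
        ∑ ρ₂ ∈ partnerPerms (S'.subtype fun w => ¬ p w), Φ₂ (slotPerm ρ₂ (fun w : {w // ¬ p w} => c w.1)) := by
  rw [sum_partnerPerms_eq_sum_sum_restrict p S', Finset.sum_mul_sum]
  refine Finset.sum_congr rfl fun ρ₁ _ => Finset.sum_congr rfl fun ρ₂ _ => ?_
  rw [restrict_piEquivPiSubtypeProd_symm_fst, restrict_piEquivPiSubtypeProd_symm_snd]

end Sums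

/-! ## §4 The stable sum of a tensor family is the product of the two stable sums -/

section Tensor

/-- **`stableSumG` OF A `{p} ⊔ {¬p}` TENSOR FAMILY IS THE PRODUCT OF THE TWO STABLE SUMS — POINTWISE FORM** ((P4), ROAD B's «first lemma»; LHref-N BOX #23: the tensor hypothesis is asked ONLY
AT THE PARTNER POINTS of `(S′, c)`, which is where ★ `orbFamGExt_of_mem_regG_of_admissible` reads the consumer's family on `RegG S′`): if
`F S′ (ρ·c) = F₁ (S′|_p) (ρ|_p · c|_p) · F₂ (S′|_{¬p}) (ρ|_{¬p} · c|_{¬p})` for every `ρ ∈ partnerPerms S′`, then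
`stableSumG F S′ c = stableSumG F₁ (S′|_p) (c|_p) · stableSumG F₂ (S′|_{¬p}) (c|_{¬p})` — the twists (§2), the labels (§3) and `slotPerm` (§1) all factor; there is NO cross-place term.
[cite: Shelstad1979, Lemma 4.2 p. 23; §4 p. 26] [cite: Rogawski1990, §4.1 (4.1.1) p. 39] [cite: BorelJacquet1979, §4.1] -/
theorem stableSumG_eq_mul_of_tensor_at {F : Finset W → (W → Fin 3 → ℝ) → ℂ} {F₁ : Finset {w // p w} → ({w // p w} → Fin 3 → ℝ) → ℂ}
    {F₂ : Finset {w // ¬ p w} → ({w // ¬ p w} → Fin 3 → ℝ) → ℂ} (S' : Finset W) (c : W → Fin 3 → ℝ)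
    (hF : ∀ ρ ∈ partnerPerms S', F S' (slotPerm ρ c) =
      F₁ (S'.subtype p) (slotPerm (fun w : {w // p w} => ρ w.1) (fun w : {w // p w} => c w.1)) *
        F₂ (S'.subtype fun w => ¬ p w) (slotPerm (fun w : {w // ¬ p w} => ρ w.1) (fun w : {w // ¬ p w} => c w.1))) :
    stableSumG F S' c =
      stableSumG F₁ (S'.subtype p) (fun w : {w // p w} => c w.1) * stableSumG F₂ (S'.subtype fun w => ¬ p w) (fun w : {w // ¬ p w} => c w.1) := by
  simp only [stableSumG_apply]
  have hterm : ∀ ρ ∈ partnerPerms S', stableTwistG S' ρ c * F S' (slotPerm ρ c) =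
      (stableTwistG (S'.subtype p) (fun w : {w // p w} => ρ w.1) (fun w : {w // p w} => c w.1) *
          F₁ (S'.subtype p) (slotPerm (fun w : {w // p w} => ρ w.1) (fun w : {w // p w} => c w.1))) *
        (stableTwistG (S'.subtype fun w => ¬ p w) (fun w : {w // ¬ p w} => ρ w.1) (fun w : {w // ¬ p w} => c w.1) *
          F₂ (S'.subtype fun w => ¬ p w) (slotPerm (fun w : {w // ¬ p w} => ρ w.1) (fun w : {w // ¬ p w} => c w.1))) := by
    intro ρ hρ
    rw [stableTwistG_eq_restrict_mul_restrict p S' ρ c, hF ρ hρ, mul_mul_mul_comm]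
  rw [Finset.sum_congr rfl hterm, sum_partnerPerms_eq_sum_sum_restrict p S', Finset.sum_mul_sum]
  refine Finset.sum_congr rfl fun ρ₁ _ => Finset.sum_congr rfl fun ρ₂ _ => ?_
  rw [restrict_piEquivPiSubtypeProd_symm_fst, restrict_piEquivPiSubtypeProd_symm_snd]

/-- **Global form**: if `F S′ c = F₁ (S′|_p) (c|_p) · F₂ (S′|_{¬p}) (c|_{¬p})` for ALL `S′, c`, then `stableSumG F S′ c = stableSumG F₁ (S′|_p) (c|_p) · stableSumG F₂ (S′|_{¬p}) (c|_{¬p})`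
(`(ρ·c)|_p = ρ|_p · c|_p` definitionally, §1). [cite: Shelstad1979, Lemma 4.2 p. 23] [cite: Rogawski1990, §4.1 (4.1.1) p. 39] -/
theorem stableSumG_eq_mul_of_tensor {F : Finset W → (W → Fin 3 → ℝ) → ℂ} {F₁ : Finset {w // p w} → ({w // p w} → Fin 3 → ℝ) → ℂ}
    {F₂ : Finset {w // ¬ p w} → ({w // ¬ p w} → Fin 3 → ℝ) → ℂ}
    (hF : ∀ (S' : Finset W) (c : W → Fin 3 → ℝ), F S' c = F₁ (S'.subtype p) (fun w : {w // p w} => c w.1) * F₂ (S'.subtype fun w => ¬ p w) (fun w : {w // ¬ p w} => c w.1))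
    (S' : Finset W) (c : W → Fin 3 → ℝ) :
    stableSumG F S' c =
      stableSumG F₁ (S'.subtype p) (fun w : {w // p w} => c w.1) * stableSumG F₂ (S'.subtype fun w => ¬ p w) (fun w : {w // ¬ p w} => c w.1) :=
  stableSumG_eq_mul_of_tensor_at p S' c fun ρ _ => hF S' (slotPerm ρ c)

end Tensor

end Literature.NumberTheory.Rogawski1990

end
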